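import Summits.QuantumFields.YangMills.Theorems.BalabanLadderROTBoundaryDecayGuard
import HarnessLib

/-!
# Crux `ROT` (stmt-QuantumFields-20042): the GUARDED infrared input BY NAME — `BoundaryDecayGuarded` closers

Helper file of the fleet lead `ym-spine-20042-p1` (generation g5), `--supports stmt-QuantumFields-20042` (count-neutral).  One-line closers over the
named, guarded infrared input `BoundaryDecayGuarded` of `Theorems/BalabanLadderROTClassDefs.lean` §7 (p499742) and the inline-hypothesis chain of
`Theorems/BalabanLadderROTBoundaryDecayGuard.lean` §5 (p499545), whose hypothesis `hBD` is the body of the §7 definition verbatim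
(`boundaryDecayGuarded_iff`, `Iff.rfl`):

* `BoundaryDecayGuarded.boundaryDecayInUnitsPos` — the per-`(G, r, a)` input behind the guards (projection);
* `BoundaryDecayGuarded.tiltInsensitivityOn` — the tilt bracket vanishes at every guarded `(G, r, a)` on the tilt cells of any Pythagorean triple;
* `BoundaryDecayGuarded.ti : BoundaryDecayGuarded → TI t.tiltCell (fittedClass t.q)`;
* `BoundaryDecayGuarded.kingOnClass_of_nrot3`, `BoundaryDecayGuarded.rotRev2'_of_nrot3`, and the skeleton-order closer
  `rotRev2'_of_nrot3_of_bdGuarded : NROT3(S₅) → BoundaryDecayGuarded → ROTRev2'`;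
* `BoundaryDecayGuarded.tiltedRegComparisonOn_iff_latticeKingWardOn` — behind the guards, N-ROT.3 on a tilt cell IS King's single-angle lattice Ward
  statement on the fitted class (the split is lossless modulo the guarded input).

§6's `BoundaryDecayAllPos` is NOT used (unsatisfiable: `not_boundaryDecayAllPos`).  Census (typed): `ROTRev2' ⇐ NROT3 king345.tiltCell (arcsin 3/5)
(fittedClass 5) ∧ BoundaryDecayGuarded`, and `BoundaryDecayGuarded ⇒ TI` (so the weaker split `NROT3 ∧ TI`, `rotRev2'_of_tilt345`, is implied).
No definition, no sorry.
-/

set_option autoImplicit false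

noncomputable section

open MeasureTheory Filter Topology
open Literature.MathematicalPhysics.QuantumFieldTheory Literature.MathematicalPhysics.QuantumLattice
open Summit.QuantumFields.YangMills.Cruxes.OSLegsFromFemtoAndGap.DlrCollarTransfer
open Summit.QuantumFields.YangMills.Cruxes.OSLegsAtWeakCouplingC.Y2Bridge

namespace Summit.QuantumFields.YangMills.Theorems.ROT

open PythTriple

/-- **Certificate**: `BoundaryDecayGuarded` (ClassDefs §7) IS the inline hypothesis `hBD` of `ti_of_boundaryDecayGuarded` /
`rotRev2'_of_nrot3_of_boundaryDecayGuarded` — a definitional identity. -/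
theorem boundaryDecayGuarded_iff :
    BoundaryDecayGuarded ↔
      ∀ (G : Type) [Group G] [TopologicalSpace G] [IsTopologicalGroup G] [CompactSpace G],
        IsCompactSimpleLieGroup G → letI : MeasurableSpace G := borel G; haveI : BorelSpace G := ⟨rfl⟩;
        ∀ (r : LatticeRep G) (a : ℝ → ℝ), (∀ β, 0 < a β) → Tendsto a atTop (𝓝 0) → MomentBounds6 G r a →
          GapInUnits G r a → BoundaryDecayInUnitsPos G r a :=
  Iff.rfl

namespace BoundaryDecayGuarded

/-- **Projection**: behind the guards, the per-`(G, r, a)` boundary-decay input of ClassDefs §6. -/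
theorem boundaryDecayInUnitsPos (h : BoundaryDecayGuarded) {G : Type} [Group G] [TopologicalSpace G] [IsTopologicalGroup G]
    [CompactSpace G] (hG : IsCompactSimpleLieGroup G) :
    letI : MeasurableSpace G := borel G; haveI : BorelSpace G := ⟨rfl⟩;
    ∀ (r : LatticeRep G) (a : ℝ → ℝ), (∀ β, 0 < a β) → Tendsto a atTop (𝓝 0) → MomentBounds6 G r a →
      GapInUnits G r a → BoundaryDecayInUnitsPos G r a :=
  h G hG

/-- **Behind the guards the tilt bracket vanishes** at `(G, r, a)` on the tilt cells of any Pythagorean triple. -/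
theorem tiltInsensitivityOn (h : BoundaryDecayGuarded) (t : PythTriple) {G : Type} [Group G] [TopologicalSpace G]
    [IsTopologicalGroup G] [CompactSpace G] (hG : IsCompactSimpleLieGroup G) :
    letI : MeasurableSpace G := borel G; haveI : BorelSpace G := ⟨rfl⟩;
    ∀ (r : LatticeRep G) (a : ℝ → ℝ), (∀ β, 0 < a β) → Tendsto a atTop (𝓝 0) → MomentBounds6 G r a →
      GapInUnits G r a → TiltInsensitivityOn G r a t.tiltCell (fittedClass t.q) := by
  letI : MeasurableSpace G := borel G
  haveI : BorelSpace G := ⟨rfl⟩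
  intro r a ha ha0 hUV hIR
  exact tiltInsensitivityOn_of_boundaryDecayInUnitsPos t r a (h G hG r a ha ha0 hUV hIR)

/-- **`TI ⇐ BoundaryDecayGuarded`** for the tilt cells of any Pythagorean triple on its fitted class. -/
theorem ti (h : BoundaryDecayGuarded) (t : PythTriple) : TI t.tiltCell (fittedClass t.q) :=
  ti_of_boundaryDecayGuarded t h

/-- **`KingOnClass ⇐ N-ROT.3 (King's data) ∧ BoundaryDecayGuarded`.** -/
theorem kingOnClass_of_nrot3 (h : BoundaryDecayGuarded) (h3 : NROT3 king345.tiltCell (Real.arcsin (3 / 5)) (fittedClass 5)) :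
    KingOnClass :=
  kingOnClass_of_nrot3_of_boundaryDecayGuarded h3 h

/-- **`ROT` rev 2′ ⇐ N-ROT.3 (King's data) ∧ BoundaryDecayGuarded.** -/
theorem rotRev2'_of_nrot3 (h : BoundaryDecayGuarded) (h3 : NROT3 king345.tiltCell (Real.arcsin (3 / 5)) (fittedClass 5)) : ROTRev2' :=
  rotRev2'_of_nrot3_of_boundaryDecayGuarded h3 h

/-- **Behind the guards, N-ROT.3 on a tilt cell IS King's single-angle lattice Ward statement on the fitted class** (the split is lossless modulo
the guarded input). -/
theorem tiltedRegComparisonOn_iff_latticeKingWardOn (h : BoundaryDecayGuarded) (t : PythTriple) (θ : ℝ) {G : Type} [Group G]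
    [TopologicalSpace G] [IsTopologicalGroup G] [CompactSpace G] (hG : IsCompactSimpleLieGroup G) :
    letI : MeasurableSpace G := borel G; haveI : BorelSpace G := ⟨rfl⟩;
    ∀ (r : LatticeRep G) (a : ℝ → ℝ), (∀ β, 0 < a β) → Tendsto a atTop (𝓝 0) → MomentBounds6 G r a → GapInUnits G r a →
      (TiltedRegComparisonOn G r a t.tiltCell θ (fittedClass t.q) ↔ LatticeKingWardOn G r a ({θ} : Set ℝ) (fittedClass t.q)) := by
  letI : MeasurableSpace G := borel G
  haveI : BorelSpace G := ⟨rfl⟩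
  intro r a ha ha0 hUV hIR
  exact tiltedRegComparisonOn_iff_latticeKingWardOn_of_boundaryDecayInUnitsPos t r a θ (h G hG r a ha ha0 hUV hIR)

end BoundaryDecayGuarded

/-- **Skeleton-order closer**: `ROT` rev 2′ (text of record for R85) from the two stubs of the split «N-ROT.3 + guarded boundary decay» —
`NROT3(S₅) → BoundaryDecayGuarded → ROTRev2'` (for a registered `stub_nrot3`, `stub_bd`; the weaker split `NROT3 ∧ TI` is `rotRev2'_of_tilt345`). -/
theorem rotRev2'_of_nrot3_of_bdGuarded (h3 : NROT3 king345.tiltCell (Real.arcsin (3 / 5)) (fittedClass 5)) (h : BoundaryDecayGuarded) :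
    ROTRev2' :=
  h.rotRev2'_of_nrot3 h3

end Summit.QuantumFields.YangMills.Theorems.ROT

end
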